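import Literature.Computability.Complexity.NPSubsetNTIME
import HarnessLib

/-!
# `NP = ⋃ₖ NTIME(nᵏ)` (Arora–Barak 2009, Thm. 2.6) — discharge of `NP_eq_iUnion_NTIME`

Literature / complexity toolkit, companion of `NPSubsetNTIME.lean` (`NP ⊆ NTIME(2ⁿ)`) and
`NTIMEWindow.lean` (total verifiers). The tree's `NP` is the certificate class `polyExists P`
(`Nondeterministic.lean`, Arora–Barak Def. 2.1: `x ∈ L ↔ ∃ y, |y| ≤ p |x| ∧ ⟨x, y⟩ ∈ L'` with
`L' ∈ P`), and `NTIME t` is the one-constant verifier form (ONE constant `c` bounds both the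
admissible witnesses `|y| ≤ c · t |x| + c` and the running time on admissible pairs). Arora–Barak's
Theorem 2.6, `NP = ⋃_{c} NTIME(n^c)` ("the sequence of nondeterministic choices made by an
accepting computation … can be viewed as a certificate … and vice versa", §2.1.2, proof on
p. 41–42), becomes in this model:

* **`NP_subset_iUnion_NTIME : NP ⊆ ⋃ₖ NTIME(nᵏ)`.** As in `NP_subset_NTIME_two_pow`: the verifier
  on `⟨x, y⟩` is the truncating wrapper `truncMapAux` (`TruncMapMachine.lean`) for the polynomial
  clock `x ↦ ⟨x, 1^{p(|x|)+1}⟩` — it CUTS an over-long witness at length `p(|x|) + 1`, reading the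
  discarded part two symbols per step — followed by a polynomial-time decider of `LenLe p ⊓ L'`
  ("the kept witness is admissible and accepted", `LengthCompare.lean`, `StringCopy.inter_mem_P`);
  the total time is a polynomial in `|x|` plus `|y| / 2`, dominated by `b · nᵈ + b`
  (`exists_eval_le_mul_pow_add`).
* **`NTIME_pow_subset_NP : NTIME(nᵏ) ⊆ NP`.** Given a presentation `(c, R₀, M)` of
  `L ∈ NTIME(nᵏ)` (specified only on admissible pairs), the composite
  `V = truncMapAux (clock x ↦ ⟨x, 1^{c|x|ᵏ+c}⟩) ⨟ M` is a TOTAL machine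
  (`outputsWithin_truncMapAux` holds on every input word `z`): it decides, in polynomial time, the
  language of pairs `L' = {z | R₀ x (r ↾ (c|x|ᵏ+c))}` where `x = (boolUnpair z).1` and
  `r = readRest z` is what the pair reader leaves (`r = y` on `z = ⟨x, y⟩`). Hence `L' ∈ P`, and
  with the witness polynomial `c Xᵏ + c` the admissible witnesses of `x` are unchanged.
* **`NP_eq_iUnion_NTIME_holds`** — the named fact `NP_eq_iUnion_NTIME` of `Nondeterministic.lean`.

## References

* S. Arora, B. Barak, *Computational Complexity: A Modern Approach*, CUP 2009, Def. 2.1, Def. 2.5,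
  Thm. 2.6 (§2.1.2, pp. 41–42), §1.3 (machine composition).
* M. Sipser, *Introduction to the Theory of Computation*, 3rd ed., Thm. 7.20 / Cor. 7.22.
-/

namespace Literature.Computability.Complexity

open _root_.Computability Turing Polynomial Brick Plumb PairFstTM

/-! ### `NP ⊆ ⋃ₖ NTIME(nᵏ)` -/

/-- **`NP ⊆ ⋃ₖ NTIME(nᵏ)`** (Arora–Barak 2009, Thm. 2.6, direction "⊆", in the tree's one-constant
verifier form of `NTIME`). For `L ∈ NP` presented by `L' ∈ P` and the witness polynomial `p`,
the verifier on `⟨x, y⟩` is the truncating wrapper `truncMapAux` for the clock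
`x ↦ ⟨x, 1^{p(|x|)+1}⟩` — output `⟨x, y ↾ (p(|x|) + 1)⟩` within `poly(|x|) + |y| / 2` steps —
followed by a polynomial-time decider of `LenLe p ⊓ L'`; the relation
"`y ↾ (p(|x|)+1)` is admissible (`≤ p |x|`) and `⟨x, y ↾ (p(|x|)+1)⟩ ∈ L'`" has exactly the
`NP`-witnesses of `x` as witnesses, and all bounds are `≤ b · |x|ᵈ + b + |y| / 2` for the
dominating power `d` of `exists_eval_le_mul_pow_add`. [cite: AroraBarak2009, Thm. 2.6] -/
theorem NP_subset_iUnion_NTIME : Nondeterministic.NP ⊆ ⋃ k : ℕ, NTIME (fun n => n ^ k) := by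
  rintro L ⟨L', hL'P, p, hL⟩
  -- a decider of `LenLe p ⊓ L'`
  have hL'' : LenLe p ⊓ L' ∈ Classes.P := inter_mem_P (LenLe_mem_P p) hL'P
  simp only [Classes.P, Set.mem_iUnion] at hL''
  obtain ⟨k, a, hdec⟩ := hL''
  obtain ⟨M, hM⟩ := (hdec : TimeDecidable id (LenLe p ⊓ L') fun n => a * n ^ k + a)
  -- the clock and the dominating power
  obtain ⟨q, N, hN⟩ := exists_machine_pair_ones p
  obtain ⟨b, d, hb⟩ := exists_eval_le_mul_pow_add
    (q + 5 * X + 13 + 2 * (p + 1) + (C a * (2 * X + 3 + p) ^ k + C a))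
  let V : TM2ComputableAux Bool Bool := (truncMapAux N).comp M
  refine Set.mem_iUnion.2 ⟨d, 2 * b + 2,
    fun x y => (LenLe p ⊓ L').boolIndicator (boolPair x (y.take (p.eval x.length + 1))), V,
    fun x y hy => ?_, fun x => ?_⟩
  · -- running time
    have h₁ := outputsWithin_truncMapAux_boolPair N (y := y) (hN x)
    simp only [List.length_replicate] at h₁
    set y' := y.take (p.eval x.length + 1) with hy'
    have hlen' : y'.length ≤ p.eval x.length + 1 := List.length_take_le _ _
    have h₂ : M.OutputsWithin (boolPair x y') (encodeBool ((LenLe p ⊓ L').boolIndicator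
        (boolPair x y'))) (a * (2 * x.length + 3 + p.eval x.length) ^ k + a) := by
      refine (hM (boolPair x y')).mono ?_
      simp only [id, length_boolPair]
      have : 2 * x.length + 2 + y'.length ≤ 2 * x.length + 3 + p.eval x.length := by omega
      exact Nat.add_le_add_right (Nat.mul_le_mul_left a (Nat.pow_le_pow_left this k)) a
    have h := Turing.TM2ComputableAux.comp_outputsWithin _ _ h₁ h₂
    refine h.mono ?_
    have hbn := hb x.length
    simp only [eval_add, eval_mul, eval_ofNat, eval_X, eval_pow, eval_C, eval_one] at hbn
    have hy2 : 2 * (y.length / 2) ≤ (2 * b + 2) * x.length ^ d + (2 * b + 2) :=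
      (Nat.mul_div_le y.length 2).trans hy
    nlinarith [hbn, hy2]
  · -- correctness
    have hind : ∀ w : List Bool, (LenLe p ⊓ L').boolIndicator w = true ↔ w ∈ LenLe p ∧ w ∈ L' :=
      fun w => (Set.mem_iff_boolIndicator ((LenLe p ⊓ L' : Language Bool) : Set (List Bool)) w).symm
    rw [hL x]
    constructor
    · rintro ⟨y₀, hy₀, hmem⟩
      refine ⟨y₀, ?_, ?_⟩
      · have hbn := hb x.length
        simp only [eval_add, eval_mul, eval_ofNat, eval_X, eval_pow, eval_C, eval_one] at hbn
        show y₀.length ≤ (2 * b + 2) * x.length ^ d + (2 * b + 2)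
        calc y₀.length ≤ p.eval x.length := hy₀
          _ ≤ b * x.length ^ d + b := by omega
          _ ≤ (2 * b + 2) * x.length ^ d + (2 * b + 2) :=
              Nat.add_le_add (Nat.mul_le_mul_right _ (by omega)) (by omega)
      · rw [hind, List.take_of_length_le (by omega), boolPair_mem_LenLe]
        exact ⟨hy₀, hmem⟩
    · rintro ⟨y, -, hR⟩
      rw [hind, boolPair_mem_LenLe] at hR
      exact ⟨_, hR.1, hR.2⟩

/-! ### `NTIME(nᵏ) ⊆ NP` -/

/-- The polynomial witness clock `x ↦ ⟨x, 1^{c·|x|ᵏ + c}⟩` of an `NTIME(nᵏ)` presentation with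
constant `c` is computed by some machine in polynomial time (`fanoutFn id (polyFn (c Xᵏ + c))`).
[folklore] -/
theorem exists_machine_pair_ones_mul_pow_add (c k : ℕ) :
    ∃ (q : Polynomial ℕ) (N : TM2ComputableAux Bool Bool),
      ∀ x : List Bool,
        N.OutputsWithin x (boolPair x (ones (c * x.length ^ k + c))) (q.eval x.length) := by
  have h : fanoutFn id (polyFn (C c * X ^ k + C c)) ∈ FP :=
    fanoutFn_mem_FP OracleCompose.id_mem_FP (polyFn_mem_FP _)
  obtain ⟨q, N, hN⟩ := h
  refine ⟨q, N, fun x => ?_⟩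
  have := hN x
  simpa [fanoutFn_apply] using this

/-- **Total polynomial-time verifier of an `NTIME(nᵏ)` language** (the machine content of
Arora–Barak 2009, Thm. 2.6, direction "⊇": "simulate the action of `N` using these
nondeterministic choices", here: cut the certificate to the admissible length, then run the given
verifier). From a presentation `(c, R₀, M)` of `L ∈ NTIME(nᵏ)` — `M` specified only on pairs
`⟨x, y⟩` with `|y| ≤ c|x|ᵏ + c` — the language of pairs
`L' = {z | R₀ x (r ↾ (c|x|ᵏ + c)) = true}`, `x = (boolUnpair z).1`, `r = readRest z`, is in `P`
(decided on EVERY word `z` by `truncMapAux (clock) ⨟ M`, `outputsWithin_truncMapAux`, within a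
polynomial of `|z|`), and `x ∈ L ↔ ∃ y, |y| ≤ c|x|ᵏ + c ∧ ⟨x, y⟩ ∈ L'`.
[cite: AroraBarak2009, Thm. 2.6] -/
theorem exists_mem_P_verifier_of_mem_NTIME_pow {L : Language Bool} {k : ℕ}
    (hL : L ∈ NTIME (fun n => n ^ k)) :
    ∃ (L' : Language Bool) (c : ℕ), L' ∈ Classes.P ∧
      ∀ x : List Bool, x ∈ L ↔
        ∃ y : List Bool, y.length ≤ c * x.length ^ k + c ∧ boolPair x y ∈ L' := by
  obtain ⟨c, R₀, M, hM, hLR⟩ := hL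
  obtain ⟨q, N, hN⟩ := exists_machine_pair_ones_mul_pow_add c k
  -- the total relation: cut what the pair reader leaves at the admissible length, then ask `R₀`
  let R : List Bool → Bool := fun z =>
    R₀ (boolUnpair z).1 ((readRest z).take (c * (boolUnpair z).1.length ^ k + c))
  let L' : Language Bool := {z | R z = true}
  let V : TM2ComputableAux Bool Bool := (truncMapAux N).comp M
  -- the dominating power of the running time
  obtain ⟨a, d, ha⟩ := exists_eval_le_mul_pow_add
    (q + 3 * X + 2 * (C c * X ^ k + C c) + X + X + 9 + (C c * X ^ k + C c))
  refine ⟨L', c, ?_, fun x => ?_⟩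
  · -- `L' ∈ P`: `V` decides `L'` within `a |z|ᵈ + a` steps on every word `z`
    simp only [Classes.P, Set.mem_iUnion]
    refine ⟨d, a, V, fun z => ?_⟩
    have hxz : (boolUnpair z).1.length ≤ z.length := length_boolUnpair_fst_le z
    have hr : (readRest z).length ≤ z.length := by
      have h1 := readSteps_add_le z
      have h2 := one_le_readSteps z
      omega
    have h₁ := outputsWithin_truncMapAux N (z := z) (hN (boolUnpair z).1)
    simp only [List.length_replicate] at h₁
    have hlen : ((readRest z).take (c * (boolUnpair z).1.length ^ k + c)).length ≤
        c * (boolUnpair z).1.length ^ k + c := List.length_take_le _ _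
    have h₂ : M.OutputsWithin
        (boolPair (boolUnpair z).1 ((readRest z).take (c * (boolUnpair z).1.length ^ k + c)))
        (encodeBool (R z)) (c * (boolUnpair z).1.length ^ k + c) := hM _ _ hlen
    have h := Turing.TM2ComputableAux.comp_outputsWithin _ _ h₁ h₂
    have hind : L'.boolIndicator z = R z := by
      rw [Bool.eq_iff_iff, ← Set.mem_iff_boolIndicator]
      exact Iff.rfl
    show V.OutputsWithin z (encodeBool (L'.boolIndicator z)) (a * z.length ^ d + a)
    rw [hind]
    refine h.mono ?_
    have haz := ha z.length
    simp only [eval_add, eval_mul, eval_ofNat, eval_X, eval_pow, eval_C] at haz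
    have hq : q.eval (boolUnpair z).1.length ≤ q.eval z.length := TM2Iter.eval_mono q hxz
    have hck : c * (boolUnpair z).1.length ^ k ≤ c * z.length ^ k :=
      Nat.mul_le_mul_left c (Nat.pow_le_pow_left hxz k)
    omega
  · -- the admissible witnesses are the same
    rw [hLR x]
    refine exists_congr fun y => and_congr_right fun hy => ?_
    have hy' : y.length ≤ c * x.length ^ k + c := hy
    show R₀ x y = true ↔ R (boolPair x y) = true
    simp only [R, boolUnpair_boolPair, readRest_boolPair, List.take_of_length_le hy']

/-- **`NTIME(nᵏ) ⊆ NP`** (Arora–Barak 2009, Thm. 2.6, direction "⊇"): the pair language `L' ∈ P`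
of `exists_mem_P_verifier_of_mem_NTIME_pow` with the witness polynomial `c Xᵏ + c`.
[cite: AroraBarak2009, Thm. 2.6] -/
theorem NTIME_pow_subset_NP (k : ℕ) : NTIME (fun n => n ^ k) ⊆ Nondeterministic.NP := by
  intro L hL
  obtain ⟨L', c, hL'P, hL⟩ := exists_mem_P_verifier_of_mem_NTIME_pow hL
  refine ⟨L', hL'P, C c * X ^ k + C c, fun x => ?_⟩
  simpa only [eval_add, eval_mul, eval_C, eval_pow, eval_X] using hL x

/-- **`⋃ₖ NTIME(nᵏ) ⊆ NP`.** [cite: AroraBarak2009, Thm. 2.6] -/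
theorem iUnion_NTIME_subset_NP : (⋃ k : ℕ, NTIME (fun n => n ^ k)) ⊆ Nondeterministic.NP :=
  Set.iUnion_subset fun k => NTIME_pow_subset_NP k

/-! ### Discharge -/

/-- **Discharge of `NP_eq_iUnion_NTIME`** (Arora–Barak 2009, Thm. 2.6: `NP = ⋃_c NTIME(n^c)`;
Sipser, Thm. 7.20): the certificate definition of `NP` agrees with the nondeterministic-time
definition, in the tree's verifier form of `NTIME` — `NP_subset_iUnion_NTIME` and
`iUnion_NTIME_subset_NP`. [cite: AroraBarak2009, Thm. 2.6] -/
theorem NP_eq_iUnion_NTIME_holds : NP_eq_iUnion_NTIME :=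
  Set.Subset.antisymm NP_subset_iUnion_NTIME iUnion_NTIME_subset_NP

end Literature.Computability.Complexity
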